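import Summits.QuantumFields.QCD.Theorems.NestedDissectionSeaLightQuarkCompletionGlue
import Summits.QuantumFields.QCD.Theorems.NestedDissectionSeaLightQuarkCompletionStubJumpGerm
import Summits.QuantumFields.QCD.Theorems.LightQuarkCompletion.Negative.Anatomy

/-!
# Crux `LightQuarkCompletion` (stmt-QuantumFields-18066) — line `Sketch` (rev 4), helper
# `stub_bandPinsAlong_of_chiralCornerPinned`: the two facts of composition B imply composition A's stub B2a

Helper of the registered skeleton rev 4 of line `Sketch` (crux `Summit.QuantumFields.QCD.Theses.NestedDissectionSea.
LightQuarkCompletion`, stmt-QuantumFields-18066; lead c3, 2026-08-17).  The skeleton closes the crux along two compositions: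
composition A through `stub_bandPinsAlong` (B2a: band pins along a subsequence `φ` at a germ `J` for the GIVEN threshold
regularisation), and composition B through the sibling item `HeavyThresholdYMBridge.ChiralCompletion` (stmt-QuantumFields-17661:
a constant RGI re-pin `δ` after which the regularisation is chiral at zero and carries the `QCDOf` body at every positive tuple)
plus the one supplier-less fact `ChiralCornerPinned` (the up-shift `upShift reg δ` at such a chiral corner carries the two-sided
parity pin at ZERO threshold).

This file certifies, by pure logic over landed glue, that composition B's two facts (taken as HYPOTHESES — neither is asserted)
imply B2a verbatim, with the trivial subsequence `φ = id` and the germ `J = δ`: item 17661 supplies `δ`; its re-pinned scheme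
`reg.scheme (m + δ)` is the scheme of `upShift reg δ` (`upShift_scheme`), so `upShift reg δ` is chiral at zero and carries the
body at every positive tuple; `ChiralCornerPinned` then gives the zero-threshold two-sided pin of `upShift reg δ`, which IS
(definitionally) `reg` re-centred at `δ`, so un-re-centring (`zeroPin_recentre_iff`, landed) yields the lower pin of `reg` from
depth `−δ` and its upper pin from height `δ`, weights at `δ + m`; heredity along `id` (`pinClause_restrict`,
`upperPin_restrict`, landed) finishes.  Sorry-free; no definition; nothing here asserts a Theses decl.
-/

noncomputable section

namespace Summit.QuantumFields.QCD.Theorems.LightQuarkJumpLine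

open MeasureTheory Filter Topology
open Literature.MathematicalPhysics.QuantumFieldTheory Literature.MathematicalPhysics.QuantumLattice
  Literature.Probability.LatticeModels
open Summit.QuantumFields.QCD.Theorems.CoerciveSeaNegative (PinClause)
open Summit.QuantumFields.QCD.Theorems.EarlyCrosserLawNegative (UpperPin)
open Summit.QuantumFields.QCD.Theorems.LightQuarkCompletion.Negative (PinPkg Body HypAt upShift upShift_scheme)

/-! ## Glue: the δ-re-pinned scheme is the up-shifted scheme; the zero pin of the up-shift is the band pin of `reg` -/

/-- The δ-re-pinned scheme of item 17661, `reg.scheme (fun f => m f + δ)`, IS the scheme of the up-shift `upShift reg δ` at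
`m` (Negative `upShift_scheme`, up to `m f + δ = δ + m f`). [folklore] -/
theorem scheme_addConst_eq_upShift_scheme {Nf : ℕ} (reg : QCDRegularisation Nf) (δ : ℝ) (m : Fin Nf → ℝ)
    (z shift : QCDField Nf → ℕ → ℝ) :
    reg.scheme (fun f => m f + δ) z shift = (upShift reg δ).scheme m z shift := by
  rw [upShift_scheme]
  congr 1
  funext f
  ring

/-- Chirality at zero of the δ-re-pinned schemes (item 17661's first conclusion, verbatim) is `IsChiralAtZero` of the
up-shift `upShift reg δ`. [folklore] -/
theorem isChiralAtZero_upShift_of_addConst {Nf : ℕ} (reg : QCDRegularisation Nf) (δ : ℝ)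
    (hχ : ∀ ε > (0 : ℝ), ∃ m : Fin Nf → ℝ, (∀ f, 0 < m f) ∧ ¬ (reg.scheme (fun f => m f + δ) 0 0).HasLatticeMassGap ε) :
    (upShift reg δ).IsChiralAtZero := by
  intro ε hε
  obtain ⟨m, hm, hng⟩ := hχ ε hε
  refine ⟨m, hm, ?_⟩
  rwa [← scheme_addConst_eq_upShift_scheme]

/-- The body at every positive tuple of the δ-re-pinned schemes (item 17661's second conclusion, verbatim) is the body of the
up-shift `upShift reg δ` above threshold `0`. [folklore] -/
theorem body_upShift_zero_of_addConst {Nf : ℕ} (reg : QCDRegularisation Nf) (δ : ℝ)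
    (h : ∀ m : Fin Nf → ℝ, (∀ f, 0 < m f) → ∃ (z shift : QCDField Nf → ℕ → ℝ) (T : OSData (QCDField Nf) 4),
      IsQCDAlong (reg.scheme (fun f => m f + δ) z shift) T ∧ T.IsNontrivial QCDField.glue ∧
        T.IsNonGaussian QCDField.glue ∧ (∀ f g : Fin Nf, f ≠ g → T.IsNontrivial (QCDField.pseudoRe f g)) ∧
          ∃ Δ > 0, T.HasMassGap Δ ∧ (reg.scheme (fun f => m f + δ) z shift).HasLatticeMassGap Δ) :
    Body Nf (upShift reg δ) 0 := by
  intro m hm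
  obtain ⟨z, shift, T, hQ, hN, hG, hP, Δ, hΔ, hT, hL⟩ := h m hm
  refine ⟨z, shift, T, ?_, hN, hG, hP, Δ, hΔ, hT, ?_⟩
  · rwa [← scheme_addConst_eq_upShift_scheme]
  · rwa [← scheme_addConst_eq_upShift_scheme]

/-- **The zero-threshold pin of the up-shift is the band pin of `reg`.**  `upShift reg δ` is, definitionally, `reg` re-centred
at the germ `δ` (`m_crit ↦ m_crit + a δ / Z_m`), so its zero-threshold two-sided pin with weights at the positive tuple `m`
un-re-centres (`zeroPin_recentre_iff`) to the lower pin of `reg` from depth `−δ` and the upper pin of `reg` from height `δ`,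
weights at `δ + m`, same radius. [folklore] -/
theorem bandPins_of_zeroPin_upShift {Nf : ℕ} (reg : QCDRegularisation Nf) (δ : ℝ) {m : Fin Nf → ℝ} {R : ℝ}
    (hlo : PinClause Nf (upShift reg δ) 0 m R) (hup : UpperPin Nf (upShift reg δ) 0 m R) :
    PinClause Nf reg (-δ) (fun f => δ + m f) R ∧ UpperPin Nf reg δ (fun f => δ + m f) R :=
  (zeroPin_recentre_iff (m := m) (R := R) reg δ).1 ⟨hlo, hup⟩

/-- **The zero-threshold pin package of the up-shift gives band pins of `reg` along the trivial subsequence.**  From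
`PinPkg Nf (upShift reg δ) 0`: for every positive tuple `m` a radius `R > 0` carries the lower pin of `reg.restrict id` from
depth `−δ` and its upper pin from height `δ`, weights at `δ + m` (un-re-centre, then heredity along `id`). [folklore] -/
theorem bandPinsAlong_id_of_pinPkg_upShift {Nf : ℕ} (reg : QCDRegularisation Nf) (δ : ℝ)
    (hP : PinPkg Nf (upShift reg δ) 0) :
    ∀ m : Fin Nf → ℝ, (∀ f, 0 < m f) → ∃ R : ℝ, 0 < R ∧
      PinClause Nf (reg.restrict id strictMono_id.tendsto_atTop) (-δ) (fun f => δ + m f) R ∧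
      UpperPin Nf (reg.restrict id strictMono_id.tendsto_atTop) δ (fun f => δ + m f) R := by
  intro m hm
  obtain ⟨R, hR, hlo, hup⟩ := hP m hm
  obtain ⟨hlo', hup'⟩ := bandPins_of_zeroPin_upShift reg δ hlo hup
  exact ⟨R, hR, pinClause_restrict reg id strictMono_id hlo', upperPin_restrict reg id strictMono_id hup'⟩

/-! ## The registered helper: composition B's two facts imply stub B2a (`stub_bandPinsAlong`) -/

/-- **Composition B's facts imply B2a (`stub_bandPinsAlong`), registered helper signature verbatim.**  HYPOTHESES (not
asserted here): (i) the text of item stmt-QuantumFields-17661 `HeavyThresholdYMBridge.ChiralCompletion` — for `N_f ∈ {2,3}`,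
every regularisation with `HasMassScaling` carrying the `QCDOf` body above SOME threshold `M₀` admits a constant RGI re-pin `δ`
after which it is chiral at zero and carries the body at EVERY positive tuple; (ii) `ChiralCornerPinned` — for every
regularisation carrying the crux's threshold package `HypAt` at `M₀`, every offset `δ` at which `upShift reg δ` is chiral at
zero and carries the body above `0` also carries the two-sided parity pin at zero threshold (`PinPkg … 0`).  CONCLUSION: B2a
for every threshold regularisation — along SOME subsequence `φ` and at SOME germ `J`, for every positive tuple a common radius
carries the lower pin of `reg.restrict φ` from depth `−J` and its upper pin from height `J`, weights at `J + m`.  Proof: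
`φ = id`, `J = δ` of (i); (ii) at the chiral corner; un-re-centre (`zeroPin_recentre_iff`); heredity along `id`. -/
theorem stub_bandPinsAlong_of_chiralCornerPinned :
    (∀ Nf : ℕ, Nf = 2 ∨ Nf = 3 → ∀ (reg : QCDRegularisation Nf) (M₀ : ℝ), reg.HasMassScaling →
      (∀ m : Fin Nf → ℝ, (∀ f, M₀ < m f) → ∃ (z shift : QCDField Nf → ℕ → ℝ) (T : OSData (QCDField Nf) 4),
        IsQCDAlong (reg.scheme m z shift) T ∧ T.IsNontrivial QCDField.glue ∧ T.IsNonGaussian QCDField.glue ∧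
          (∀ f g : Fin Nf, f ≠ g → T.IsNontrivial (QCDField.pseudoRe f g)) ∧
            ∃ Δ > 0, T.HasMassGap Δ ∧ (reg.scheme m z shift).HasLatticeMassGap Δ) →
      ∃ δ : ℝ, (∀ ε > (0 : ℝ), ∃ m : Fin Nf → ℝ, (∀ f, 0 < m f) ∧
          ¬ (reg.scheme (fun f => m f + δ) 0 0).HasLatticeMassGap ε) ∧
        ∀ m : Fin Nf → ℝ, (∀ f, 0 < m f) → ∃ (z shift : QCDField Nf → ℕ → ℝ) (T : OSData (QCDField Nf) 4),
          IsQCDAlong (reg.scheme (fun f => m f + δ) z shift) T ∧ T.IsNontrivial QCDField.glue ∧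
            T.IsNonGaussian QCDField.glue ∧ (∀ f g : Fin Nf, f ≠ g → T.IsNontrivial (QCDField.pseudoRe f g)) ∧
              ∃ Δ > 0, T.HasMassGap Δ ∧ (reg.scheme (fun f => m f + δ) z shift).HasLatticeMassGap Δ) →
    (∀ Nf : ℕ, (Nf = 2 ∨ Nf = 3) → ∀ (reg : QCDRegularisation Nf) (M₀ : ℝ),
      Summit.QuantumFields.QCD.Theorems.LightQuarkCompletion.Negative.HypAt Nf reg M₀ → ∀ δ : ℝ,
      (Summit.QuantumFields.QCD.Theorems.LightQuarkCompletion.Negative.upShift reg δ).IsChiralAtZero →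
      Summit.QuantumFields.QCD.Theorems.LightQuarkCompletion.Negative.Body Nf
        (Summit.QuantumFields.QCD.Theorems.LightQuarkCompletion.Negative.upShift reg δ) 0 →
      Summit.QuantumFields.QCD.Theorems.LightQuarkCompletion.Negative.PinPkg Nf
        (Summit.QuantumFields.QCD.Theorems.LightQuarkCompletion.Negative.upShift reg δ) 0) →
    ∀ Nf : ℕ, (Nf = 2 ∨ Nf = 3) → ∀ reg : QCDRegularisation Nf, reg.HasMassScaling →
    (reg.scheme 0 0 0).HasAsymptoticScaling → (∀ᶠ k : ℕ in Filter.atTop, -1 ≤ reg.mcrit k) → ∀ M₀ : ℝ, 0 ≤ M₀ →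
    (∀ m : Fin Nf → ℝ, (∀ f, M₀ < m f) → ∃ R : ℝ, 0 < R ∧
      Summit.QuantumFields.QCD.Theorems.CoerciveSeaNegative.PinClause Nf reg M₀ m R ∧
      Summit.QuantumFields.QCD.Theorems.EarlyCrosserLawNegative.UpperPin Nf reg M₀ m R) →
    (∀ m : Fin Nf → ℝ, (∀ f, M₀ < m f) → ∃ (z shift : QCDField Nf → ℕ → ℝ) (T : OSData (QCDField Nf) 4),
      IsQCDAlong (reg.scheme m z shift) T ∧ T.IsNontrivial QCDField.glue ∧ T.IsNonGaussian QCDField.glue ∧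
        (∀ f g : Fin Nf, f ≠ g → T.IsNontrivial (QCDField.pseudoRe f g)) ∧
          ∃ Δ > 0, T.HasMassGap Δ ∧ (reg.scheme m z shift).HasLatticeMassGap Δ) →
    ∃ (φ : ℕ → ℕ) (hφ : StrictMono φ) (J : ℝ), ∀ m : Fin Nf → ℝ, (∀ f, 0 < m f) → ∃ R : ℝ, 0 < R ∧
      Summit.QuantumFields.QCD.Theorems.CoerciveSeaNegative.PinClause Nf (reg.restrict φ hφ.tendsto_atTop) (-J)
        (fun f => J + m f) R ∧
      Summit.QuantumFields.QCD.Theorems.EarlyCrosserLawNegative.UpperPin Nf (reg.restrict φ hφ.tendsto_atTop) J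
        (fun f => J + m f) R := by
  intro h17661 hCP Nf hNf reg hMS hAS hbr M₀ hM₀ hpin hbody
  -- item 17661: the chiral corner `δ`, with the body at every positive tuple, read on the up-shift `upShift reg δ`
  obtain ⟨δ, hχ, hbodyδ⟩ := h17661 Nf hNf reg M₀ hMS hbody
  have hχ' : (upShift reg δ).IsChiralAtZero := isChiralAtZero_upShift_of_addConst reg δ hχ
  have hbody' : Body Nf (upShift reg δ) 0 := body_upShift_zero_of_addConst reg δ hbodyδ
  -- the chiral corner is pinned: the zero-threshold two-sided pin of the up-shift
  have hP0 : PinPkg Nf (upShift reg δ) 0 := hCP Nf hNf reg M₀ ⟨hMS, hAS, hbr, hM₀, hpin, hbody⟩ δ hχ' hbody'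
  -- band pins of `reg` along the trivial subsequence at the germ `δ`
  exact ⟨id, strictMono_id, δ, bandPinsAlong_id_of_pinPkg_upShift reg δ hP0⟩

end Summit.QuantumFields.QCD.Theorems.LightQuarkJumpLine

end
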